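import Mathlib
import Summits.Ventures.PercRepro2.HCov
import Summits.Ventures.PercRepro2.HCovSwap
import Summits.Ventures.PercRepro2.RV
import Summits.Ventures.PercRepro2.RVBridge
import Summits.Ventures.PercRepro2.CaseOneRV
import Summits.Ventures.PercRepro2.HubBernstein
import Summits.Ventures.PercRepro2.K5Kernel
import Summits.Ventures.PercRepro2.K5Conn
import Summits.Ventures.PercRepro2.K5Kron
import Summits.Ventures.PercRepro2.K5Digits
import Summits.Ventures.PercRepro2.K5Theorem

/-!
# (i) IS A THEOREM ON `K₅` FOR EVERY WEIGHT VECTOR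
(blind cell PercRepro2, typer-1 g9; the `(i)` twin of `K5Theorem.lean`)

p1's cleared (i) is `CaseOne.iExpr = −(P(Q)·E[1_{bL} Z 1_Q] − E[1_{bL} 1_Q]·E[Z 1_Q])` with
`Z = 1[a₃ ∈ C₁](D·1[o ∈ C₂] − D_o)` (`CaseOne.ZSplitI := 0 ≤ iExpr`).  In event probabilities
(`iExpr_eq_probs`, the `b ∈ C₁` twin of p1's `iiExpr_eq_probs`) it is the negative of
`P(Q)·(D·P(Q,a₃∈C₁,o∈C₂,b∈C₁) − D_o·P(Q,a₃∈C₁,b∈C₁)) − P(Q,b∈C₁)·(D·P(Q,a₃∈C₁,o∈C₂) − D_o·P(Q,a₃∈C₁))`,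
a cubic in Bernstein-1 forms whose degree-3 coefficients are `cntPos₁ − cntNeg₁` (`iTable_eq_bern`);
`K5Digits.cntPos₁_le_cntNeg₁` (from the kernel certificate `K5.cert_i`) makes them `≤ 0`, so

* **`zSplitI_K5`**: `CaseOne.ZSplitI p ends5 0 1 2 3 4` for every admissible `p : Fin 10 → R` — (i) on
  `K₅`, every weight vector; with `K5Theorem.zSplitII_K5`, p1's `CaseOne.jOneOne_of_i_of_ii` gives
  **`jOneOne_K5`**: (J1₁) on `K₅`, every weight vector.
-/

namespace Summit.Ventures.PercRepro2

open Hub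

namespace K5

section ISide

variable {R : Type*} [Field R] [LinearOrder R] [IsStrictOrderedRing R]

omit [LinearOrder R] [IsStrictOrderedRing R] in
/-- The cleared (i) of p1 in event probabilities (the `b ∈ C₁` twin of `CaseOne.iiExpr_eq_probs`), for any
finite graph. -/
lemma iExpr_eq_probs {V E : Type*} [Fintype E] [DecidableEq E] (p : E → R) (ends : E → Sym2 V)
    (o a₁ a₂ a₃ b : V) :
    CaseOne.iExpr p ends o a₁ a₂ a₃ b =
      -(prob p (connEvent ends a₁ a₂)ᶜ *
          (CaseOne.Dpd p ends a₁ a₂ a₃ * prob p (connEvent ends a₁ b ∩ connEvent ends a₁ a₃ ∩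
              connEvent ends a₂ o ∩ (connEvent ends a₁ a₂)ᶜ) -
            CaseOne.Dpdo p ends o a₁ a₂ a₃ * prob p (connEvent ends a₁ b ∩ connEvent ends a₁ a₃ ∩
              (connEvent ends a₁ a₂)ᶜ)) -
        prob p (connEvent ends a₁ b ∩ (connEvent ends a₁ a₂)ᶜ) *
          (CaseOne.Dpd p ends a₁ a₂ a₃ * prob p (connEvent ends a₁ a₃ ∩ connEvent ends a₂ o ∩
              (connEvent ends a₁ a₂)ᶜ) -
            CaseOne.Dpdo p ends o a₁ a₂ a₃ * prob p (connEvent ends a₁ a₃ ∩ (connEvent ends a₁ a₂)ᶜ))) := by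
  unfold CaseOne.iExpr CaseOne.zFun
  have e1 : expect p (fun ω => (connEvent ends a₁ b).indicator (1 : Config E → R) ω *
      ((connEvent ends a₁ a₃).indicator 1 ω *
        (CaseOne.Dpd p ends a₁ a₂ a₃ * (connEvent ends a₂ o).indicator 1 ω -
          CaseOne.Dpdo p ends o a₁ a₂ a₃)) *
      ((connEvent ends a₁ a₂)ᶜ).indicator 1 ω) =
      expect p (fun ω => ((connEvent ends a₁ b).indicator (1 : Config E → R) ω *
        (connEvent ends a₁ a₃).indicator 1 ω) *
        (CaseOne.Dpd p ends a₁ a₂ a₃ * (connEvent ends a₂ o).indicator 1 ω -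
          CaseOne.Dpdo p ends o a₁ a₂ a₃) *
        ((connEvent ends a₁ a₂)ᶜ).indicator 1 ω) := by
    congr 1
    funext ω
    ring
  rw [e1, CaseOne.expect_mul_affine, CaseOne.expect_mul_affine]
  simp only [CaseOne.expect_ind4, CaseOne.expect_ind3, CaseOne.expect_ind2]

omit [LinearOrder R] [IsStrictOrderedRing R] in
/-- The masses of the (i) side as Bernstein-1 forms (`K5Conn.lean` tables). -/
lemma massesI (p : Fin 10 → R) :
    prob p (connEvent ends5 1 4 ∩ connEvent ends5 1 3 ∩ connEvent ends5 2 0 ∩ (connEvent ends5 1 2)ᶜ) =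
        bform p (indR tABOL) ∧
    prob p (connEvent ends5 1 4 ∩ connEvent ends5 1 3 ∩ (connEvent ends5 1 2)ᶜ) = bform p (indR tABL) ∧
    prob p (connEvent ends5 1 4 ∩ (connEvent ends5 1 2)ᶜ) = bform p (indR tQBL) ∧
    prob p (connEvent ends5 1 3 ∩ connEvent ends5 2 0 ∩ (connEvent ends5 1 2)ᶜ) = bform p (indR tAO) ∧
    prob p (connEvent ends5 1 3 ∩ (connEvent ends5 1 2)ᶜ) = bform p (indR tA) ∧
    prob p (connEvent ends5 1 2)ᶜ = bform p (indR tQ) ∧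
    CaseOne.Dpd p ends5 1 2 3 = bform p (indR tPD) ∧
    CaseOne.Dpdo p ends5 0 1 2 3 = bform p (indR tPDoU) := by
  have hQ : (connEvent ends5 1 2)ᶜ = avoidAll ends5 2 {1} := CovForm.compl_connEvent_eq_Q ends5 1 2
  refine ⟨?_, ?_, ?_, ?_, ?_, ?_, ?_, ?_⟩
  · rw [show connEvent ends5 1 4 ∩ connEvent ends5 1 3 ∩ connEvent ends5 2 0 ∩ (connEvent ends5 1 2)ᶜ =
        avoidAll ends5 2 {1} ∩ connEvent ends5 1 3 ∩ connEvent ends5 1 4 ∩ connEvent ends5 2 0 from by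
      rw [hQ]; ext ω; simp only [Set.mem_inter_iff]; tauto]
    exact prob_eq_bform p _ _ tABOL_iff
  · rw [show connEvent ends5 1 4 ∩ connEvent ends5 1 3 ∩ (connEvent ends5 1 2)ᶜ =
        avoidAll ends5 2 {1} ∩ connEvent ends5 1 3 ∩ connEvent ends5 1 4 from by
      rw [hQ]; ext ω; simp only [Set.mem_inter_iff]; tauto]
    exact prob_eq_bform p _ _ tABL_iff
  · rw [show connEvent ends5 1 4 ∩ (connEvent ends5 1 2)ᶜ = avoidAll ends5 2 {1} ∩ connEvent ends5 1 4 from by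
      rw [hQ]; exact Set.inter_comm _ _]
    exact prob_eq_bform p _ _ tQBL_iff
  · rw [show connEvent ends5 1 3 ∩ connEvent ends5 2 0 ∩ (connEvent ends5 1 2)ᶜ =
        avoidAll ends5 2 {1} ∩ connEvent ends5 1 3 ∩ connEvent ends5 2 0 from by
      rw [hQ]; ext ω; simp only [Set.mem_inter_iff]; tauto]
    exact prob_eq_bform p _ _ tAO_iff
  · rw [show connEvent ends5 1 3 ∩ (connEvent ends5 1 2)ᶜ = avoidAll ends5 2 {1} ∩ connEvent ends5 1 3 from by
      rw [hQ]; exact Set.inter_comm _ _]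
    exact prob_eq_bform p _ _ tA_iff
  · rw [hQ]
    exact prob_eq_bform p _ _ tQ_iff
  · rw [J1RV.Dpd_eq]
    exact prob_eq_bform p _ _ tPD_iff
  · rw [J1RV.Dpdo_eq, Do_eq_prob]
    exact prob_eq_bform p _ _ tPDoU_iff

omit [LinearOrder R] [IsStrictOrderedRing R] in
/-- **The cleared (i) in the degree-3 Bernstein basis**: `−iExpr = Σ_k bern p k · (cntPos₁ k − cntNeg₁ k)`. -/
theorem neg_iExpr_eq_bern (p : Fin 10 → R) :
    -CaseOne.iExpr p ends5 0 1 2 3 4 = ∑ k, bern p k * ((cntPos₁ k : ℕ) - (cntNeg₁ k : ℕ) : R) := by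
  obtain ⟨h1, h2, h3, h4, h5, h6, h7, h8⟩ := massesI p
  rw [iExpr_eq_probs, neg_neg, h1, h2, h3, h4, h5, h6, h7, h8]
  have e : bform p (indR tQ) * (bform p (indR tPD) * bform p (indR tABOL) -
        bform p (indR tPDoU) * bform p (indR tABL)) -
      bform p (indR tQBL) * (bform p (indR tPD) * bform p (indR tAO) -
        bform p (indR tPDoU) * bform p (indR tA)) =
      bform p (indR tABOL) * bform p (indR tQ) * bform p (indR tPD) +
        bform p (indR tQBL) * bform p (indR tPDoU) * bform p (indR tA) -
        bform p (indR tQBL) * bform p (indR tAO) * bform p (indR tPD) -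
        bform p (indR tABL) * bform p (indR tPDoU) * bform p (indR tQ) := by ring
  rw [e, bform_mul_mul, bform_mul_mul, bform_mul_mul, bform_mul_mul,
    ← Finset.sum_add_distrib, ← Finset.sum_sub_distrib, ← Finset.sum_sub_distrib]
  refine Finset.sum_congr rfl fun k _ => ?_
  rw [coef3_eq_cnt3, coef3_eq_cnt3, coef3_eq_cnt3, coef3_eq_cnt3]
  unfold cntPos₁ cntNeg₁
  push_cast
  ring

/-- **(i) of the Z-split on `K₅`, every weight vector** (`CaseOne.ZSplitI`). -/
theorem zSplitI_K5 (p : Fin 10 → R) (hp : IsProbVec p) : CaseOne.ZSplitI p ends5 0 1 2 3 4 := by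
  unfold CaseOne.ZSplitI
  rw [← neg_neg (CaseOne.iExpr p ends5 0 1 2 3 4), neg_iExpr_eq_bern, Left.nonneg_neg_iff]
  refine Finset.sum_nonpos fun k _ => ?_
  refine mul_nonpos_of_nonneg_of_nonpos (bern_nonneg (fun i => ⟨hp.nonneg i, hp.le_one i⟩) k) ?_
  rw [sub_nonpos]
  exact_mod_cast cntPos₁_le_cntNeg₁ k

/-- **(J1₁) on `K₅`, every weight vector**: from (i) and (ii) (p1's `jOneOne_of_i_of_ii`). -/
theorem jOneOne_K5 (p : Fin 10 → R) (hp : IsProbVec p) : CaseOne.JOneOne p ends5 0 1 2 3 4 :=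
  CaseOne.jOneOne_of_i_of_ii p ends5 0 1 2 3 4 (zSplitI_K5 p hp) (zSplitII_K5 p hp)

end ISide

end K5

end Summit.Ventures.PercRepro2
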